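import Mathlib.Data.Nat.Choose.Sum
import Literature.Algebra.EuclideanLattices.KhotRandomSublattice
import HarnessLib

/-!
# Khot 2005, §§4–5: the counting — few index sets in small fibres (Lemma 4.3), the good family (Lemmas 5.4, 5.7, 5.8), the number of annoying vectors (Lemma 5.5)

Topic `Algebra/EuclideanLattices`, namespace `Literature.Algebra.EuclideanLattices.Khot`. Sixth
brick of the decomposition of `Literature.Algebra.EuclideanLattices.gapSVP_const_isNPHardRandomized`
(pqc.S17) through `Khot2005_SAT_randReducible_gapSVP` (`KhotSVPHardness.lean`; earlier bricks
`KhotTensorBoost`, `KhotBasicReduction`, `KhotGapInstance`, `KhotRandomSublattice`,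
`InformationTheory/Coding/BCHIndependence`, `Computability/Complexity/GapSetCover`). All proved:

* `card_filter_small_fibre_le` — the pigeonhole of Lemma 4.3: under any map into a finite type
  `β`, at most `|β| · B` elements of a finite set lie in fibres of size `< B` ("a fraction … of
  the `r`-subsets" — with `β = GF(2)ʰ`: a random `r`-set of columns has a column sum `s` with
  `K_s < B = C(N,r)/(100·2ʰ)` with probability `≤ 1/100`).
* `card_not_injective_le`, `card_mul_pow_ge_of_image` — sampling an `r`-set by an `r`-tuple of
  uniform indices: at most `r²|α|^{r-1}` tuples collide, and a family of tuples with images of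
  size `≤ r` has at least `|family|/r^r` distinct images (the tuple-to-set loss).
* `sparseVectors`, `card_sparseVectors_le` — integer vectors with coordinates in `(-D, D)` and at
  most `m₀` nonzero coordinates number at most `(m₀+1)·n^{m₀}·(2D)^{m₀}`;
  `card_annoyingVectors_intBasis_le` — **Lemma 5.5**: in the NO case every annoying vector of the
  intermediate lattice is such a vector with `m₀ = ⌊(d-1)/4⌋` (by `Khot.intBasis_annoying`: `j₀ = 0`
  and all coordinates even, so annoyance forces `4·#nonzero < d`), whence the bound on `#A`.
* `goodSets P s' r` (the `K_{s'}` good index sets of Lemma 4.3), `goodVector` (the good vector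
  `B_int(1_T ∘ z_J ∘ (-1))` of Lemma 5.4), `goodVector_eq` / `goodVector_data` (it is the
  `{0,1,2}`-vector `(0 ∘ 2·1_T) ∘ (0 ∘ 1_J)` of squared norm `4|T| + |J|`, with a coefficient vector
  of squared norm `≤ |T| + |J| + h|J|² + 1` — the YES data of `Khot.yes_finBasis`), and
  `card_no_good_survivor_mul_le` — **Lemmas 5.7–5.8 for this family**:
  `#{r | no good vector has r·v ≡ 0 (mod q)} · K_{s'} ≤ q^{rows+1}`.

## Faithfulness / rendering

* Printed `#A ≤ C(N+h, d/2ᵖ)·d^{40C'kd}` (Lemma 5.5) comes from bounding the CVP block by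
  `(2d^{20k})^{C'd}`; here both blocks are bounded through sparsity (an annoying vector has fewer
  than `d/4` nonzero coordinates in total), giving `(m₀+1)·n^{m₀}·(2D)^{m₀}` with `n` the number of
  rows. This is what frees the assembly from the printed (but not vendored) linear-size property
  `n' = C₁d, n'' = Cd` of the Exact Set Cover instances (`GapSetCover.lean` vendors ABSS 1997
  Prop. 6 as printed, without it).
* Probabilities are cardinalities multiplied through by denominators, as in
  `KhotRandomSublattice.lean`; arbitrary modulus `q`.

## References

* S. Khot, *Hardness of approximating the shortest vector problem in lattices*, J. ACM 52 (2005)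
  789–808, Lemma 4.3 (p. 798–799), Def. 5.2–5.3, Lemmas 5.4–5.5 (pp. 800–801), Lemmas 5.7–5.8
  (p. 803).
-/

namespace Literature.Algebra.EuclideanLattices.Khot

open Matrix Finset

/-! ### Fibres of a map on a finite set: few elements lie in small fibres (Lemma 4.3) -/

section Fibres

variable {α β : Type} [DecidableEq β]

/-- **Pigeonhole behind Lemma 4.3** ("Vector `s ∈ GF(2)ʰ` is picked as follows: Pick `r` columns
of the matrix `P_BCH` at random and define `s` to be their sum … `Pr[K_s ≤ (1/100)·C(N,r)/2ʰ]
≤ 1/100`"). For any map `f` on a finite set `s` into a finite type `β` and any bound `B`, the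
number of elements of `s` lying in a fibre of size `< B` is at most `|β| · B` (sum over the small
fibres). With `f = ` column sum of an `r`-set of columns, `|β| = 2ʰ` and `B = C(N,r)/(100·2ʰ)`,
a uniformly random `r`-set has a column sum occurring `< B` times with probability `≤ 1/100`.
[cite: Khot2005, Lemma 4.3 (proof)] -/
theorem card_filter_small_fibre_le [Fintype β] (s : Finset α) (f : α → β) (B : ℕ) :
    #(s.filter fun a => #(s.filter fun a' => f a' = f a) < B) ≤ Fintype.card β * B := by
  classical
  set bad := s.filter fun a => #(s.filter fun a' => f a' = f a) < B with hbad
  -- fibrewise decomposition of `bad` over its image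
  have hdecomp := Finset.card_eq_sum_card_fiberwise (f := f) (s := bad) (t := univ)
    (fun a _ => mem_univ (f a))
  rw [hdecomp]
  calc ∑ b ∈ (univ : Finset β), #(bad.filter fun a => f a = b) ≤ ∑ _b ∈ (univ : Finset β), B := by
        refine Finset.sum_le_sum fun b _ => ?_
        by_cases hb : ∃ a ∈ bad, f a = b
        · obtain ⟨a, ha, rfl⟩ := hb
          have hsmall : #(s.filter fun a' => f a' = f a) < B := (mem_filter.1 ha).2
          refine le_trans (card_le_card fun a' ha' => ?_) hsmall.le
          exact mem_filter.2 ⟨(mem_filter.1 (mem_filter.1 ha').1).1, (mem_filter.1 ha').2⟩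
        · push Not at hb
          rw [Finset.card_eq_zero.2 (Finset.filter_eq_empty_iff.2 fun a ha h => hb a ha h)]
          exact Nat.zero_le _
    _ = Fintype.card β * B := by rw [Finset.sum_const, smul_eq_mul, Finset.card_univ]

end Fibres

/-! ### Sparse bounded integer vectors and the number of annoying vectors (Lemma 5.5) -/

section Sparse

variable {ι : Type} [Fintype ι] [DecidableEq ι]

/-- The integer vectors with all coordinates in `(-D, D)` and at most `m₀` nonzero coordinates.
[cite: Khot2005, Lemma 5.5 (proof)] -/
noncomputable def sparseVectors (ι : Type) [Fintype ι] [DecidableEq ι] (D m₀ : ℕ) : Finset (ι → ℤ) :=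
  (Fintype.piFinset fun _ : ι => Finset.Ioo (-(D : ℤ)) D).filter fun w => hammingNorm w ≤ m₀

/-- Membership in `sparseVectors`. [cite: Khot2005, Lemma 5.5 (proof)] -/
theorem mem_sparseVectors {D m₀ : ℕ} {w : ι → ℤ} :
    w ∈ sparseVectors ι D m₀ ↔ (∀ i, |w i| < D) ∧ hammingNorm w ≤ m₀ := by
  simp only [sparseVectors, mem_filter, Fintype.mem_piFinset, mem_Ioo, abs_lt]

/-- The vectors supported inside `T` with coordinates in `(-D, D)`: a product of `|T|` intervals
and singletons `{0}`, of cardinality `(2D - 1)^{|T|}` for `D ≥ 1`. [cite: Khot2005, Lemma 5.5 (proof)] -/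
theorem card_piFinset_support (T : Finset ι) {D : ℕ} (hD : 1 ≤ D) :
    #(Fintype.piFinset fun i : ι => if i ∈ T then Finset.Ioo (-(D : ℤ)) D else {0}) =
      (2 * D - 1) ^ T.card := by
  rw [Fintype.card_piFinset]
  have hIoo : #(Finset.Ioo (-(D : ℤ)) D) = 2 * D - 1 := by
    rw [Int.card_Ioo]
    omega
  have h1 : ∀ i ∈ (univ : Finset ι), #(if i ∈ T then Finset.Ioo (-(D : ℤ)) D else {0}) =
      if i ∈ T then 2 * D - 1 else 1 := fun i _ => by
    split_ifs <;> simp [hIoo]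
  rw [Finset.prod_congr rfl h1, Finset.prod_ite_mem, Finset.univ_inter, Finset.prod_const]

/-- **Counting sparse bounded vectors** (the shape count behind Lemma 5.5): the number of integer
vectors on `ι` with coordinates in `(-D, D)` and at most `m₀` nonzero coordinates is at most
`(m₀ + 1) · |ι|^{m₀} · (2D)^{m₀}` (choose the support, `∑_{j ≤ m₀} C(|ι|, j) ≤ (m₀+1)|ι|^{m₀}`
ways, then the values). [cite: Khot2005, Lemma 5.5 (proof)] -/
theorem card_sparseVectors_le (D m₀ : ℕ) (hD : 1 ≤ D) (hι : 1 ≤ Fintype.card ι) :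
    #(sparseVectors ι D m₀) ≤ (m₀ + 1) * Fintype.card ι ^ m₀ * (2 * D) ^ m₀ := by
  classical
  -- cover by supports of size `≤ m₀`
  have hcover : sparseVectors ι D m₀ ⊆ ((univ : Finset ι).powerset.filter fun T => T.card ≤ m₀).biUnion
      fun T => Fintype.piFinset fun i : ι => if i ∈ T then Finset.Ioo (-(D : ℤ)) D else {0} := by
    intro w hw
    obtain ⟨hbd, hsp⟩ := mem_sparseVectors.1 hw
    refine mem_biUnion.2 ⟨univ.filter fun i => w i ≠ 0, mem_filter.2 ⟨mem_powerset.2 (filter_subset _ _), hsp⟩, ?_⟩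
    refine Fintype.mem_piFinset.2 fun i => ?_
    by_cases hi : w i = 0
    · have hni : i ∉ univ.filter (fun i => w i ≠ 0) := by simp [hi]
      rw [if_neg hni, hi]
      exact mem_singleton_self 0
    · have hii : i ∈ univ.filter (fun i => w i ≠ 0) := by simp [hi]
      rw [if_pos hii, mem_Ioo, ← abs_lt]
      exact hbd i
  refine (card_le_card hcover).trans (card_biUnion_le.trans ?_)
  calc ∑ T ∈ (univ : Finset ι).powerset.filter (fun T => T.card ≤ m₀),
        #(Fintype.piFinset fun i : ι => if i ∈ T then Finset.Ioo (-(D : ℤ)) D else {0})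
      ≤ ∑ _T ∈ (univ : Finset ι).powerset.filter (fun T => T.card ≤ m₀), (2 * D) ^ m₀ := by
        refine Finset.sum_le_sum fun T hT => ?_
        rw [card_piFinset_support T hD]
        calc (2 * D - 1) ^ T.card ≤ (2 * D) ^ T.card := Nat.pow_le_pow_left (Nat.sub_le _ _) _
          _ ≤ (2 * D) ^ m₀ := Nat.pow_le_pow_right (by omega) (mem_filter.1 hT).2
    _ = #((univ : Finset ι).powerset.filter fun T => T.card ≤ m₀) * (2 * D) ^ m₀ := by
        rw [Finset.sum_const, smul_eq_mul]
    _ ≤ ((m₀ + 1) * Fintype.card ι ^ m₀) * (2 * D) ^ m₀ := by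
        refine Nat.mul_le_mul_right _ ?_
        -- `#{T | |T| ≤ m₀} = ∑_{j ≤ m₀} C(n, j) ≤ (m₀ + 1) n^{m₀}`
        have hsplit : ((univ : Finset ι).powerset.filter fun T => T.card ≤ m₀) =
            (Finset.range (m₀ + 1)).biUnion fun j => (univ : Finset ι).powersetCard j := by
          ext T
          simp only [mem_filter, mem_powerset, subset_univ, true_and, mem_biUnion, mem_range,
            mem_powersetCard, Nat.lt_succ_iff]
          exact ⟨fun h => ⟨T.card, h, rfl⟩, fun ⟨j, hj, hTj⟩ => hTj ▸ hj⟩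
        rw [hsplit]
        refine card_biUnion_le.trans ?_
        calc ∑ j ∈ Finset.range (m₀ + 1), #((univ : Finset ι).powersetCard j)
            ≤ ∑ _j ∈ Finset.range (m₀ + 1), Fintype.card ι ^ m₀ := by
              refine Finset.sum_le_sum fun j hj => ?_
              rw [Finset.card_powersetCard, Finset.card_univ]
              calc (Fintype.card ι).choose j ≤ Fintype.card ι ^ j := Nat.choose_le_pow _ _
                _ ≤ Fintype.card ι ^ m₀ := Nat.pow_le_pow_right hι (Nat.lt_succ_iff.1 (mem_range.1 hj))
          _ = (m₀ + 1) * Fintype.card ι ^ m₀ := by rw [Finset.sum_const, smul_eq_mul, Finset.card_range]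

end Sparse

/-! ### The number of annoying vectors of the intermediate lattice (Lemma 5.5) -/

section AnnoyingCount

variable {U S H Nn : Type} [Fintype U] [Fintype S] [Fintype H] [Fintype Nn]
variable [DecidableEq U] [DecidableEq S] [DecidableEq H] [DecidableEq Nn]

/-- **Khot 2005, Lemma 5.5 (the bound on the number of annoying vectors), `p = 2`.** In the NO
case (no `< d` sets cover the universe), with `d`-wise independent `P` and `0 ≤ Q`, `D ≤ Q`,
every annoying vector of the intermediate lattice has `j₀ = 0` and all coordinates even
(`Khot.intBasis_annoying`), hence — being annoying — fewer than `d/4` nonzero coordinates, all of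
magnitude `< D`: the annoying vectors form a subset of the sparse bounded vectors, so
`#A ≤ (m₀+1) · n^{m₀} · (2D)^{m₀}` with `m₀ = ⌊(d-1)/4⌋` and `n` the number of rows. (Printed:
`#A ≤ C(N+h, d/2ᵖ) · d^{40C'kd}`, from a coarser shape count; any bound of this polynomial shape
serves §5.2.) [cite: Khot2005, Lemma 5.5] -/
theorem card_annoyingVectors_intBasis_le {Q : ℤ} (hQ : 0 ≤ Q) (F : S → Finset U)
    {P : Matrix H Nn ℤ} {d D : ℕ} (hNO : ∀ T : Finset S, T.card < d → ∃ e : U, ∀ j ∈ T, e ∉ F j)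
    (hP : DWise P d) (hDQ : (D : ℤ) ≤ Q) (hD : 1 ≤ D) (s' : H → ℤ)
    (hrows : 1 ≤ Fintype.card ((U ⊕ S) ⊕ (H ⊕ Nn))) :
    #(annoyingVectors (intBasis Q F P s') d D) ≤
      ((d - 1) / 4 + 1) * Fintype.card ((U ⊕ S) ⊕ (H ⊕ Nn)) ^ ((d - 1) / 4) * (2 * D) ^ ((d - 1) / 4) := by
  classical
  refine le_trans (card_le_card fun v hv => ?_) (card_sparseVectors_le D ((d - 1) / 4) hD hrows)
  obtain ⟨⟨x, rfl⟩, hA⟩ := mem_annoyingVectors.1 hv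
  rw [intCoeff_parts x] at hA ⊢
  obtain ⟨-, heven⟩ := intBasis_annoying hQ F hNO hP hDQ s' _ _ _ _ hA
  obtain ⟨-, hsmall, -, hnot⟩ := hA
  refine mem_sparseVectors.2 ⟨hsmall, ?_⟩
  have : ¬(d ≤ 4 * hammingNorm (intBasis Q F P s' *ᵥ intCoeff (fun j => x (Sum.inl (Sum.inl j)))
      (fun i => x (Sum.inl (Sum.inr (Sum.inl i)))) (fun r => x (Sum.inl (Sum.inr (Sum.inr r))))
      (x (Sum.inr ())))) := fun h => hnot ⟨heven, h⟩
  omega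

end AnnoyingCount

/-! ### The good family of Lemma 5.4 and the YES count (Lemmas 5.7–5.8) -/

section GoodFamily

variable {U S H Nn : Type} [Fintype U] [Fintype S] [Fintype H] [Fintype Nn]
variable [DecidableEq U] [DecidableEq S] [DecidableEq H] [DecidableEq Nn]

/-- The parity condition of Lemma 4.3 on an index set `J`: the `GF(2)`-sum of the columns of `P`
indexed by `J` is `s'` ("`v_J ≡ s'` over `GF(2)`"). [cite: Khot2005, Lemma 4.3 (proof)] -/
def ColParityOK (P : Matrix H Nn ℤ) (s' : H → ℤ) (J : Finset Nn) : Prop :=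
  ∀ r, Even ((P *ᵥ indicator J) r - s' r)

/-- **The good index sets** (Khot 2005, Lemma 4.3 / Lemma 5.4): the `r`-subsets `J` of the
columns whose `GF(2)`-sum is `s'`; their number is the `K_{s'}` of Lemma 4.3, and each yields a
good vector of the intermediate lattice. [cite: Khot2005, Lemma 4.3 and Lemma 5.4] -/
noncomputable def goodSets (P : Matrix H Nn ℤ) (s' : H → ℤ) (rr : ℕ) : Finset (Finset Nn) := by
  classical
  exact ((univ : Finset Nn).powersetCard rr).filter (ColParityOK P s')

omit [Fintype H] [DecidableEq H] in
/-- Membership in `goodSets`. [cite: Khot2005, Lemma 4.3] -/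
theorem mem_goodSets {P : Matrix H Nn ℤ} {s' : H → ℤ} {rr : ℕ} {J : Finset Nn} :
    J ∈ goodSets P s' rr ↔ J.card = rr ∧ ColParityOK P s' J := by
  classical
  unfold goodSets
  simp [mem_powersetCard]

/-- The BCH coefficient part `y_J` of the good coefficient vector of `J` (Lemma 4.3:
`yᵢ = ½((i-th co-ordinate of s') - (i-th co-ordinate of v_J))`). [cite: Khot2005, Lemma 4.3 (proof)] -/
def goodY (P : Matrix H Nn ℤ) (s' : H → ℤ) (J : Finset Nn) : H → ℤ :=
  fun r => (s' r - (P *ᵥ indicator J) r) / 2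

/-- **The good vector of `J`** (Khot 2005, Lemma 5.4): `B_int (ỹ ∘ z_J ∘ (-1))` for the exact
cover `ỹ = 1_T` and the Lemma-4.3 coefficient vector `z_J = 1_J ∘ y_J`. [cite: Khot2005, Lemma 5.4] -/
def goodVector (Q : ℤ) (F : S → Finset U) (P : Matrix H Nn ℤ) (s' : H → ℤ) (T : Finset S)
    (J : Finset Nn) : (U ⊕ S) ⊕ (H ⊕ Nn) → ℤ :=
  intBasis Q F P s' *ᵥ intCoeff (indicator T) (indicator J) (goodY P s' J) (-1)

/-- The good vector of a good `J` is `(0 ∘ 2·1_T) ∘ (0 ∘ 1_J)` (Lemma 5.4 via Thm. 3.1 (3) and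
Lemma 4.3): a `{0,1,2}`-vector with `|T|` twos and `|J|` ones. [cite: Khot2005, Lemma 5.4 (proof)] -/
theorem goodVector_eq {Q : ℤ} {F : S → Finset U} {P : Matrix H Nn ℤ}
    (hP01 : ∀ r i, P r i = 0 ∨ P r i = 1) {s' : H → ℤ} (hs01 : ∀ r, s' r = 0 ∨ s' r = 1)
    {T : Finset S} (hT : cvpBasis Q F *ᵥ indicator T - cvpTarget Q = Sum.elim (0 : U → ℤ) (indicator T))
    {J : Finset Nn} (hJ : ColParityOK P s' J) :
    goodVector Q F P s' T J =
      Sum.elim (Sum.elim (0 : U → ℤ) ((2 : ℤ) • indicator T)) (Sum.elim (0 : H → ℤ) (indicator J)) :=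
  (intBasis_good Q F P s' hT (bch_good_vector (Q := Q) hP01 hs01 J hJ).1).1

/-- **The YES data of a good vector** (input of `Khot.yes_finBasis`): it is a `{0,1,2}`-vector of
squared norm `4|T| + |J|` (printed `2ᵖηd + r = γd`), and its coefficient vector has squared norm
`≤ |T| + (|J| + h|J|²) + 1` (printed `‖ỹ‖ₚᵖ + ‖z‖ₚᵖ + 1 ≤ (d log N)^{2.5p}`).
[cite: Khot2005, Lemma 5.4 (proof)] -/
theorem goodVector_data {Q : ℤ} {F : S → Finset U} {P : Matrix H Nn ℤ}
    (hP01 : ∀ r i, P r i = 0 ∨ P r i = 1) {s' : H → ℤ} (hs01 : ∀ r, s' r = 0 ∨ s' r = 1)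
    {T : Finset S} (hT : cvpBasis Q F *ᵥ indicator T - cvpTarget Q = Sum.elim (0 : U → ℤ) (indicator T))
    {J : Finset Nn} (hJ : ColParityOK P s' J) :
    (∀ i, goodVector Q F P s' T J i = 0 ∨ goodVector Q F P s' T J i = 1 ∨ goodVector Q F P s' T J i = 2) ∧
      intSqNorm (goodVector Q F P s' T J) = 4 * T.card + J.card ∧
      intSqNorm (intCoeff (indicator T) (indicator J) (goodY P s' J) (-1)) ≤
        T.card + (J.card + Fintype.card H * (J.card : ℤ) ^ 2) + 1 := by
  have hgood := intBasis_good Q F P s' hT (bch_good_vector (Q := Q) hP01 hs01 J hJ).1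
  refine ⟨fun i => ?_, hgood.2, ?_⟩
  · rw [goodVector, show goodY P s' J = fun r => (s' r - (P *ᵥ indicator J) r) / 2 from rfl, hgood.1]
    rcases i with (e | j) | (r | i)
    · exact Or.inl rfl
    · by_cases h : j ∈ T <;> simp [indicator, h]
    · exact Or.inl rfl
    · by_cases h : i ∈ J <;> simp [indicator, h]
  · rw [intSqNorm_intCoeff]
    have hT' : intSqNorm (indicator (S := S) T) = T.card := by
      unfold intSqNorm indicator
      simp only [ite_pow, one_pow, zero_pow (two_ne_zero), Finset.sum_boole]
      congr 1
      simp
    have hz := (bch_good_vector (Q := Q) hP01 hs01 J hJ).2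
    rw [hT']
    have : intSqNorm (Sum.elim (indicator J) (goodY P s' J)) ≤ J.card + Fintype.card H * (J.card : ℤ) ^ 2 := hz
    nlinarith

omit [Fintype H] [DecidableEq H] in
/-- Distinct good sets of a common size have "private" elements on both sides.
[folklore] -/
theorem exists_mem_sdiff_of_mem_goodSets {P : Matrix H Nn ℤ} {s' : H → ℤ} {rr : ℕ}
    {J J' : Finset Nn} (hJ : J ∈ goodSets P s' rr) (hJ' : J' ∈ goodSets P s' rr) (hne : J ≠ J') :
    ∃ i, i ∈ J ∧ i ∉ J' := by
  have hcard : J.card = J'.card := by rw [(mem_goodSets.1 hJ).1, (mem_goodSets.1 hJ').1]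
  have hnot : ¬J ⊆ J' := fun h => hne (Finset.eq_of_subset_of_card_le h hcard.ge)
  exact Finset.not_subset.1 hnot

variable {q : ℕ} [NeZero q]

/-- **Lemmas 5.7–5.8 for the good family of Lemma 5.4, counting form.** In the YES case (exact
cover `T`, good shift `s'`), the number of `r ∈ (ℤ/q)^{rows}` for which NO good vector survives
(`r·(B_int x_J) ≢ 0 (mod q)` for all good `J` of size `rr ≥ 1`) satisfies
`#{r | no survivor} · K_{s'} ≤ q^{rows} · q` — "with probability `99/100`, there exists a good
vector `B_int x*` such that `r(B_int x*) ≡ 0 (mod q)`" as soon as `K_{s'} ≥ 100q`. The pairwise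
independence comes from the private elements `i ∈ J ∖ J'`, `i' ∈ J' ∖ J` (identity minor of the
`0/1` block), `card_no_survivor_mul_le`. [cite: Khot2005, Lemma 5.7 and Lemma 5.8] -/
theorem card_no_good_survivor_mul_le {Q : ℤ} {F : S → Finset U} {P : Matrix H Nn ℤ}
    (hP01 : ∀ r i, P r i = 0 ∨ P r i = 1) {s' : H → ℤ} (hs01 : ∀ r, s' r = 0 ∨ s' r = 1)
    {T : Finset S} (hT : cvpBasis Q F *ᵥ indicator T - cvpTarget Q = Sum.elim (0 : U → ℤ) (indicator T))
    {rr : ℕ} (hrr : 1 ≤ rr) :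
    #{r : (U ⊕ S) ⊕ (H ⊕ Nn) → ZMod q |
        ∀ J ∈ goodSets P s' rr, r ⬝ᵥ residues q (goodVector Q F P s' T J) ≠ 0} *
      #(goodSets P s' rr) ≤ q ^ Fintype.card ((U ⊕ S) ⊕ (H ⊕ Nn)) * q := by
  classical
  have hval : ∀ J ∈ goodSets P s' rr, ∀ i : Nn,
      goodVector Q F P s' T J (Sum.inr (Sum.inr i)) = if i ∈ J then 1 else 0 := by
    intro J hJ i
    rw [goodVector_eq hP01 hs01 hT (mem_goodSets.1 hJ).2]
    simp [indicator]
  have hone : ∀ J ∈ goodSets P s' rr, ∃ i, goodVector Q F P s' T J i = 1 := by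
    intro J hJ
    have hne : J.Nonempty := by
      rw [← Finset.card_pos, (mem_goodSets.1 hJ).1]; exact hrr
    obtain ⟨i, hi⟩ := hne
    exact ⟨Sum.inr (Sum.inr i), by rw [hval J hJ, if_pos hi]⟩
  have hpair : ∀ J ∈ goodSets P s' rr, ∀ J' ∈ goodSets P s' rr, J ≠ J' →
      ∃ i i', goodVector Q F P s' T J i = 1 ∧ goodVector Q F P s' T J' i = 0 ∧
        goodVector Q F P s' T J i' = 0 ∧ goodVector Q F P s' T J' i' = 1 := by
    intro J hJ J' hJ' hJJ'
    obtain ⟨i, hiJ, hiJ'⟩ := exists_mem_sdiff_of_mem_goodSets hJ hJ' hJJ'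
    obtain ⟨i', hi'J', hi'J⟩ := exists_mem_sdiff_of_mem_goodSets hJ' hJ (Ne.symm hJJ')
    exact ⟨Sum.inr (Sum.inr i), Sum.inr (Sum.inr i'), by rw [hval J hJ, if_pos hiJ],
      by rw [hval J' hJ', if_neg hiJ'], by rw [hval J hJ, if_neg hi'J], by rw [hval J' hJ', if_pos hi'J']⟩
  have h := @card_no_survivor_mul_le ((U ⊕ S) ⊕ (H ⊕ Nn)) _ _ q _ _ _ (goodSets P s' rr)
    (goodVector Q F P s' T) hone hpair
  convert h using 3
  ext r
  simp only [Finset.mem_filter]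

end GoodFamily

/-! ### Sampling index sets by tuples: collisions and the tuple-to-set loss -/

section Tuples

variable {α : Type} [Fintype α] [DecidableEq α]

/-- **Collisions of a random tuple.** The number of maps `g : Fin r → α` that are NOT injective
is at most `r² · |α|^{r-1}` (union over the pairs `i ≠ j` of `{g | g i = g j}`, each of size
`|α|^{r-1}`). Sampling an `r`-set of columns (Lemma 4.3: "pick `r` columns of the matrix `P_BCH`
at random") by an `r`-tuple of independent uniform indices thus fails with probability
`≤ r²/|α|`. [folklore] -/
theorem card_not_injective_le (r : ℕ) :
    #((univ : Finset (Fin r → α)).filter fun g => ¬Function.Injective g) ≤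
      r ^ 2 * Fintype.card α ^ (r - 1) := by
  classical
  -- cover by the events `g i = g j`, `i ≠ j`
  have hcover : ((univ : Finset (Fin r → α)).filter fun g => ¬Function.Injective g) ⊆
      ((univ : Finset (Fin r × Fin r)).filter fun p => p.1 ≠ p.2).biUnion
        fun p => univ.filter fun g : Fin r → α => g p.1 = g p.2 := by
    intro g hg
    have hg' : ¬Function.Injective g := (mem_filter.1 hg).2
    unfold Function.Injective at hg'
    push Not at hg'
    obtain ⟨i, j, hij, hne⟩ := hg'
    exact mem_biUnion.2 ⟨(i, j), mem_filter.2 ⟨mem_univ _, hne⟩, mem_filter.2 ⟨mem_univ _, hij⟩⟩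
  refine (card_le_card hcover).trans (card_biUnion_le.trans ?_)
  -- each event has `|α|^{r-1}` elements: `g` is determined by its restriction off `p.1`
  have hevent : ∀ p ∈ (univ : Finset (Fin r × Fin r)).filter (fun p => p.1 ≠ p.2),
      #(univ.filter fun g : Fin r → α => g p.1 = g p.2) ≤ Fintype.card α ^ (r - 1) := by
    intro p hp
    have hne : p.1 ≠ p.2 := (mem_filter.1 hp).2
    -- inject into the functions on `{i // i ≠ p.1}`
    let ρ : (Fin r → α) → ({i : Fin r // i ≠ p.1} → α) := fun g i => g i.1
    have hinj : Set.InjOn ρ (univ.filter fun g : Fin r → α => g p.1 = g p.2 : Finset (Fin r → α)) := by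
      intro g hg g' hg' hgg'
      have h1 : g p.1 = g p.2 := (mem_filter.1 hg).2
      have h2 : g' p.1 = g' p.2 := (mem_filter.1 hg').2
      funext i
      by_cases hi : i = p.1
      · subst hi
        rw [h1, h2]
        exact congrFun hgg' ⟨p.2, hne.symm⟩
      · exact congrFun hgg' ⟨i, hi⟩
    calc #(univ.filter fun g : Fin r → α => g p.1 = g p.2)
        ≤ #(univ : Finset ({i : Fin r // i ≠ p.1} → α)) :=
          Finset.card_le_card_of_injOn ρ (fun g _ => mem_univ _) hinj
      _ = Fintype.card α ^ (r - 1) := by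
          rw [Finset.card_univ, Fintype.card_fun, Fintype.card_subtype_compl, Fintype.card_fin,
            Fintype.card_subtype_eq]
  calc ∑ p ∈ (univ : Finset (Fin r × Fin r)).filter (fun p => p.1 ≠ p.2),
        #(univ.filter fun g : Fin r → α => g p.1 = g p.2)
      ≤ ∑ _p ∈ (univ : Finset (Fin r × Fin r)).filter (fun p => p.1 ≠ p.2), Fintype.card α ^ (r - 1) :=
        Finset.sum_le_sum hevent
    _ ≤ ∑ _p ∈ (univ : Finset (Fin r × Fin r)), Fintype.card α ^ (r - 1) :=
        Finset.sum_le_sum_of_subset_of_nonneg (filter_subset _ _) fun _ _ _ => Nat.zero_le _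
    _ = r ^ 2 * Fintype.card α ^ (r - 1) := by
        rw [Finset.sum_const, smul_eq_mul, Finset.card_univ, Fintype.card_prod, Fintype.card_fin, sq]

omit [Fintype α] in
/-- **Tuple-to-set loss.** At most `r^r` tuples `g : Fin r → α` have image inside a given set of
size `≤ r` (they are maps into it); hence a family of tuples whose images have size `≤ r`
determines at least `|family| / r^r` distinct images: `#(family) ≤ r^r · #(images)`.
[folklore] -/
theorem card_mul_pow_ge_of_image (r : ℕ) (G : Finset (Fin r → α))
    (hG : ∀ g ∈ G, #((univ : Finset (Fin r)).image g) ≤ r) :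
    #G ≤ r ^ r * #(G.image fun g => (univ : Finset (Fin r)).image g) := by
  classical
  refine Finset.card_le_mul_card_image (f := fun g : Fin r → α => (univ : Finset (Fin r)).image g)
    G (r ^ r) fun J hJ => ?_
  obtain ⟨g₀, hg₀, rfl⟩ := mem_image.1 hJ
  -- the fibre consists of maps into the image of `g₀`
  calc #(G.filter fun g => (univ : Finset (Fin r)).image g = (univ : Finset (Fin r)).image g₀)
      ≤ #(Fintype.piFinset fun _ : Fin r => (univ : Finset (Fin r)).image g₀) := by
        refine card_le_card fun g hg => Fintype.mem_piFinset.2 fun i => ?_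
        rw [← (mem_filter.1 hg).2]
        exact mem_image_of_mem g (mem_univ i)
    _ = #((univ : Finset (Fin r)).image g₀) ^ r := by
        rw [Fintype.card_piFinset, Finset.prod_const, Finset.card_univ, Fintype.card_fin]
    _ ≤ r ^ r := Nat.pow_le_pow_left (hG g₀ hg₀) r

end Tuples

end Literature.Algebra.EuclideanLattices.Khot
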